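import Mathlib
import Summits.Ventures.PercRepro.TriangleCapSevenElevenE

/-!
# PercRepro — towards the cell `(7, 11)`: the three-triangle configurations (p3, gen 35; part 35l)

Three triangles `u v w`, `a b c`, `x y z` of a `K₄⁻`-free graph on `7` vertices, `x` off the first two, no outer
vertex for any of them.

* `adj_of_mem_triangle` — two distinct vertices of a triangle are adjacent;
* **`alpha_bound`** — `y` in the first triangle, `z` in the second: the first two triangles are vertex-disjoint
  (a shared vertex would close a fourth triangle on the edge `y z`), the two other vertices of the first
  triangle have neighbours in the second, off `z`, and those pairs are far from `x`: `Σ₀ ≥ 4`;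
* **`beta_bound`** — `y` in the first triangle, `z` off both: the first two triangles share a vertex `s`
  (else eight vertices); `y = s` is the three triangles through `s`, which admit no further edge
  (`m ≤ 9 < 11`); `y ≠ s` is the path of three triangles, where `x` and `z` have neighbours in the second
  triangle off `s`, and those pairs are far from the third vertex of the first triangle: `Σ₀ ≥ 4`.

Axioms: standard.
-/

namespace PercRepro

namespace TriangleCap

namespace C047

open Finset

variable {V : Type*} [Fintype V] [DecidableEq V]

omit [Fintype V] [DecidableEq V] in
/-- Two distinct vertices of a triangle are adjacent. -/
theorem adj_of_mem_triangle (D : SimpleGraph V) [DecidableRel D.Adj] {p q s y z : V} (hpq : D.Adj p q)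
    (hps : D.Adj p s) (hqs : D.Adj q s) (hy : y = p ∨ y = q ∨ y = s) (hz : z = p ∨ z = q ∨ z = s)
    (hne : y ≠ z) : D.Adj y z := by
  rcases hy with rfl | rfl | rfl <;> rcases hz with rfl | rfl | rfl
  · exact (hne rfl).elim
  · exact hpq
  · exact hps
  · exact hpq.symm
  · exact (hne rfl).elim
  · exact hqs
  · exact hps.symm
  · exact hqs.symm
  · exact (hne rfl).elim

/-- **CONFIGURATION α:** `y` in the first triangle, `z` in the second. -/
theorem alpha_bound (D : SimpleGraph V) [DecidableRel D.Adj] (hK : K4mFree D) (hk : Fintype.card V = 7)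
    {u v w a b c x y z : V} (huv : D.Adj u v) (huw : D.Adj u w) (hvw : D.Adj v w) (hab : D.Adj a b)
    (hac : D.Adj a c) (hbc : D.Adj b c) (hxy : D.Adj x y) (hxz : D.Adj x z) (hyz : D.Adj y z)
    (hx1 : ¬ (x = u ∨ x = v ∨ x = w)) (hx2 : ¬ (x = a ∨ x = b ∨ x = c))
    (hy : y = u ∨ y = v ∨ y = w) (hz : z = a ∨ z = b ∨ z = c) (hO2 : outer D a b c = ∅) :
    4 ≤ ∑ p ∈ adjPairsAll D, (if codeg D p = 0 then deficit D p else 0) := by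
  have hyz' := hyz.ne
  -- `x` has a single neighbour in each of the first two triangles
  have hx_only1 : ∀ t, (t = u ∨ t = v ∨ t = w) → D.Adj x t → t = y := by
    intro t ht hxt
    by_contra hne
    exact not_adj_two_of_triangle D hK huv huw hvw hx1 ht hy hne hxt hxy
  have hx_only2 : ∀ t, (t = a ∨ t = b ∨ t = c) → D.Adj x t → t = z := by
    intro t ht hxt
    by_contra hne
    exact not_adj_two_of_triangle D hK hab hac hbc hx2 ht hz hne hxt hxz
  -- the first two triangles are vertex-disjoint
  have hdisj : ∀ t, (t = u ∨ t = v ∨ t = w) → (t = a ∨ t = b ∨ t = c) → False := by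
    intro t ht1 ht2
    by_cases hty : t = y
    · subst hty
      exact not_adj_two_of_triangle D hK hab hac hbc hx2 ht2 hz hyz' hxy hxz
    · have htz : t ≠ z := by
        rintro rfl
        exact not_adj_two_of_triangle D hK huv huw hvw hx1 hy ht1 hyz' hxy hxz
      have h1 : D.Adj t y := adj_of_mem_triangle D huv huw hvw ht1 hy hty
      have h2 : D.Adj t z := adj_of_mem_triangle D hab hac hbc ht2 hz htz
      have htx : x ≠ t := fun h => hx1 (h ▸ ht1)
      exact not_adj_both D hK hyz hxy.symm hxz.symm htx h1.symm h2.symm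
  have hT1T2 : ∀ t, (t = u ∨ t = v ∨ t = w) → ¬ (t = a ∨ t = b ∨ t = c) := fun t h1 h2 => hdisj t h1 h2
  have hT2T1 : ∀ t, (t = a ∨ t = b ∨ t = c) → ¬ (t = u ∨ t = v ∨ t = w) := fun t h2 h1 => hdisj t h1 h2
  -- every vertex is one of the seven
  have hseven : ∀ t : V, t = u ∨ t = v ∨ t = w ∨ t = a ∨ t = b ∨ t = c ∨ t = x := by
    apply seven_mem hk
    have hau := hT2T1 a (by simp)
    have hbu := hT2T1 b (by simp)
    have hcu := hT2T1 c (by simp)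
    simp only [not_or] at hau hbu hcu hx1 hx2
    rw [card_insert_of_notMem, card_insert_of_notMem, card_insert_of_notMem, card_insert_of_notMem,
      card_insert_of_notMem, card_insert_of_notMem, card_singleton]
    all_goals simp [huv.ne, huw.ne, hvw.ne, hab.ne, hac.ne, hbc.ne, Ne.symm hau.1,
      Ne.symm hau.2.1, Ne.symm hau.2.2, Ne.symm hbu.1, Ne.symm hbu.2.1, Ne.symm hbu.2.2, Ne.symm hcu.1,
      Ne.symm hcu.2.1, Ne.symm hcu.2.2, Ne.symm hx1.1, Ne.symm hx1.2.1, Ne.symm hx1.2.2, Ne.symm hx2.1,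
      Ne.symm hx2.2.1, Ne.symm hx2.2.2]
  -- the generic step for a vertex `p` of the first triangle other than `y`
  have step : ∀ p, (p = u ∨ p = v ∨ p = w) → p ≠ y → ∃ σ, (σ = a ∨ σ = b ∨ σ = c) ∧ D.Adj p σ ∧
      codeg D (p, σ) = 0 ∧ 1 ≤ deficit D (p, σ) := by
    intro p hp hpy
    have hp2 : ¬ (p = a ∨ p = b ∨ p = c) := hT1T2 p hp
    have hpO : p ∉ outer D a b c := by rw [hO2]; exact notMem_empty p
    obtain ⟨σ, hσ, hpσ⟩ : ∃ σ, (σ = a ∨ σ = b ∨ σ = c) ∧ D.Adj p σ := by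
      rcases adj_of_not_outer D hpO with h | h | h
      · exact ⟨a, by simp, h.symm⟩
      · exact ⟨b, by simp, h.symm⟩
      · exact ⟨c, by simp, h.symm⟩
    have hσ1 : ¬ (σ = u ∨ σ = v ∨ σ = w) := hT2T1 σ hσ
    have hσz : σ ≠ z := by
      rintro rfl
      have hpx : x ≠ p := fun h => hx1 (h ▸ hp)
      exact not_adj_both D hK hyz hxy.symm hxz.symm hpx
        (adj_of_mem_triangle D huv huw hvw hy hp (Ne.symm hpy)) hpσ.symm
    have hxp : ¬ D.Adj x p := fun h => hpy (hx_only1 p hp h)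
    have hxσ : ¬ D.Adj x σ := fun h => hσz (hx_only2 σ hσ h)
    refine ⟨σ, hσ, hpσ, ?_, one_le_deficit D (fun h => hxp h.symm) (fun h => hxσ h.symm)⟩
    unfold codeg
    rw [card_eq_zero, filter_eq_empty_iff]
    intro t _ ht
    have ht1 : D.Adj p t := ht.1
    have ht2 : D.Adj σ t := ht.2
    rcases hseven t with h | h | h | h | h | h | h
    · exact not_adj_two_of_triangle D hK huv huw hvw hσ1 hp (by simp [h]) ht1.ne hpσ.symm ht2
    · exact not_adj_two_of_triangle D hK huv huw hvw hσ1 hp (by simp [h]) ht1.ne hpσ.symm ht2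
    · exact not_adj_two_of_triangle D hK huv huw hvw hσ1 hp (by simp [h]) ht1.ne hpσ.symm ht2
    · exact not_adj_two_of_triangle D hK hab hac hbc hp2 hσ (by simp [h]) ht2.ne hpσ ht1
    · exact not_adj_two_of_triangle D hK hab hac hbc hp2 hσ (by simp [h]) ht2.ne hpσ ht1
    · exact not_adj_two_of_triangle D hK hab hac hbc hp2 hσ (by simp [h]) ht2.ne hpσ ht1
    · subst h; exact hxp ht1.symm
  -- the two vertices of the first triangle other than `y`
  have pick : ∃ p p', (p = u ∨ p = v ∨ p = w) ∧ (p' = u ∨ p' = v ∨ p' = w) ∧ p ≠ p' ∧ p ≠ y ∧ p' ≠ y := by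
    rcases hy with rfl | rfl | rfl
    · exact ⟨v, w, by simp, by simp, hvw.ne, huv.ne.symm, huw.ne.symm⟩
    · exact ⟨u, w, by simp, by simp, huw.ne, huv.ne, hvw.ne.symm⟩
    · exact ⟨u, v, by simp, by simp, huv.ne, huw.ne, hvw.ne⟩
  obtain ⟨p, p', hp, hp', hpp', hpy, hp'y⟩ := pick
  obtain ⟨σ, hσ, hpσ, hc, hd⟩ := step p hp hpy
  obtain ⟨σ', hσ', hpσ', hc', hd'⟩ := step p' hp' hp'y
  have hσσ' : σ ≠ σ' := by
    rintro rfl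
    exact not_adj_two_of_triangle D hK huv huw hvw (hT2T1 σ hσ) hp hp' hpp' hpσ.symm hpσ'.symm
  exact four_le_sum_codeg_zero_pairs D hpp' (fun h => hT1T2 p hp (by rw [h]; exact hσ'))
    (fun h => hT2T1 σ hσ (by rw [h]; exact hp')) hσσ' hpσ hpσ' hc hc' hd hd'

end C047

end TriangleCap

end PercRepro
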